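import Summits.ResolutionOfSingularities.ResolutionOfSingularities.Theorems.HilbertSamuelEliminationSigmaMaxModificationsCorridor3OriginAlongReaches
import Summits.ResolutionOfSingularities.ResolutionOfSingularities.Theorems.HilbertSamuelEliminationCampaignW42WtopConfinement
import Summits.ResolutionOfSingularities.ResolutionOfSingularities.Theorems.HilbertSamuelEliminationSigmaMaxModificationsCorridor3WLadderMovingIsoDefs
import Literature.AlgebraicGeometry.Resolution.PermissibleBlowupHilbertSamuel
import Literature.AlgebraicGeometry.Resolution.HilbertSamuelMaxValuesNonincrease
import HarnessLib

/-!
# [OURS · L1 W4.2] MAXIMAL ORIGINS ASCEND PERMISSIBLE BLOW-UPS at closed points of the `ν`-stratum; every stage of an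
# isolated E3 point tower over a maximal origin is a maximal origin (crux `SigmaMaxModifications`
# stmt-ResolutionOfSingularities-18506, conjunct `SigmaMaxModificationsCorridor3` stmt-…-19249; line `w_ladder` v6; sequel of
# `…Corridor3OriginAlongReaches` — INPUT BRICKS for the W4.2 DEAL row D7 «ISO-TAIL EXTRACTION» (stalk-iso tower route, step (d):
# level transport up the tower) and for the analyses of `IdeasL1Idea2R4.IsoQuadraticTowerTerminates` (C4 / T3))

Reserve prover res-type-071 (gen 19). Helper file `--supports stmt-ResolutionOfSingularities-19249`; kernel only (no named-fact
hypotheses, no new definitions, no `sorry`).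

THE POINT. `…Corridor3OriginAlongReaches` transports `IsMaximalOrigin p N ν` along the CANONICAL sequence (`Reaches`) and along open
immersions. The towers of the W-top core (`IsIsoPointTower`: centres = the marked closed points, `H^N ≡ ν` at the marked points, D7's
re-based stalk-iso towers) are NOT literally reached stages, so the same origin data is supplied here along an ARBITRARY permissible
blow-up: if `(X, x)` is a maximal origin for `(p, N, ν)`, `π : X' → X` the blow-up of `X` in a PERMISSIBLE centre, and `x' ∈ X'` a
CLOSED point with `H^N_{X'}(x') = ν`, then `(X', x')` is a maximal origin for `(p, N, ν)` — `X'` is reduced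
(`IsBlowup.isReduced_of_isReduced`), separated of finite type over the same field (`π` is proper), `dim X' ≤ dim X ≤ N`
(`IsBlowup.topologicalKrullDim_le_of_isLocallyNoetherian`), and `ν` is still MAXIMAL on `X'`: CJS Cor. 3.12 («for `ν ∈ Σ_X^max`,
either `ν ∉ Σ_{X'}` or `ν ∈ Σ_{X'}^max`», tree `Scheme.maximal_hsValues_of_hmono`) from the PROVED Thm. 3.10 (1)
`IsBlowup.hsFun_le_of_isPermissible` (excellence of `X` by Stacks 07QW over a field).

* §1 `IsMaximalOrigin.of_isBlowup_of_isPermissible`; the point-centre form `IsMaximalOrigin.of_isBlowup_singleton` (a closed point `x₀`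
  with `dim 𝒪_{X,x₀} > 0` is a permissible centre, `isPermissible_vanishingIdeal_singleton_of_ringKrullDim_pos`), and
  `…_of_le_geomDirDim` (`1 ≤ ē_{x₀}` suffices: `ē ≤ dim 𝒪`).
* §2 `IdeasL1Idea2R4.IsIsoPointTower.isMaximalOrigin` — along an isolated E3 point tower over a maximal origin EVERY stage `(T.X n, pt n)`
  is a maximal origin for `(p, N, ν)`; corollaries: `ν` is a maximal value of every stage, the `ν`-strata lie in the Hilbert–Samuel
  loci, `H^N ≤ ν` near `pt n` (u.s.c., by `…OriginAlongReaches` §5), and the pointed restart data at every stage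
  (`IsIsoPointTower.exists_opens_pointed`).

OURS bookkeeping; NOT a statement of the manuscript [Hironaka2017] nor of [CossartJannsenSaito2020]. AI-written; AI review is weaker
than expert review.

## References
* V. Cossart, U. Jannsen, S. Saito, *Desingularization: Invariants and Strategy*, LNM 2270 (2020): Def. 2.35, Def. 3.1 (2), Thm. 3.10 (1),
  Cor. 3.12, Def. 6.34, Def. 6.38, Def. 13.3. [CossartJannsenSaito2020]
* U. Görtz, T. Wedhorn, *Algebraic Geometry I* (2nd ed. 2020), Prop. 13.96 (1). [GortzWedhorn2020]
-/

noncomputable section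

set_option linter.dupNamespace false -- mandated namespace of this single-conjunct summit

open CategoryTheory AlgebraicGeometry TopologicalSpace Topology

namespace Summit.ResolutionOfSingularities.ResolutionOfSingularities.Theorems

namespace CampaignW42

open Literature.AlgebraicGeometry.Resolution Literature.RingTheory.HilbertSamuel
open Literature.AlgebraicGeometry.CossartJannsenSaito2020
open Summit.ResolutionOfSingularities.ResolutionOfSingularities.Theorems.SigmaMaxModificationsCorridor3
open Summit.ResolutionOfSingularities.ResolutionOfSingularities.Theorems.SigmaMaxModificationsCorridor3.Helpers (QPointed)

universe u

variable {p N : ℕ} {ν : ℕ → ℕ}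

/-! ## §1. Maximal origins ascend permissible blow-ups at closed points of the `ν`-stratum -/

/-- **MAXIMAL ORIGINS ASCEND PERMISSIBLE BLOW-UPS.** If `(X, x)` is a maximal origin for `(p, N, ν)`, `π : X' → X` is the blow-up of
`X` in a PERMISSIBLE centre `D` (CJS Def. 3.1), and `x' ∈ X'` is a CLOSED point with `H^N_{X'}(x') = ν`, then `(X', x')` is a maximal
origin for `(p, N, ν)`: `X'` is reduced, separated and of finite type over the same field, `dim X' ≤ N`, and `ν` is a maximal value of
`H^N_{X'}` (Cor. 3.12 from Thm. 3.10 (1), `H^N_{X'} ≤ H^N_X ∘ π`). The point `x'` need not lie over `x`.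
[cite: CossartJannsenSaito2020, Cor. 3.12, Thm. 3.10 (1)] -/
theorem IsMaximalOrigin.of_isBlowup_of_isPermissible {X X' : Scheme.{u}} [IsLocallyNoetherian X] {x : X}
    (hX : IsMaximalOrigin p N ν X x) {π : X' ⟶ X} {D : X.IdealSheafData} (hπ : IsBlowup π D)
    (hD : IdealSheafData.IsPermissible D) {x' : X'} (hcl : IsClosed ({x'} : Set X')) (hν : Scheme.hsFun X' N x' = ν) :
    IsMaximalOrigin p N ν X' x' := by
  obtain ⟨k, _, _, f, hsep, hft, hqc⟩ := hX.exists_structure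
  haveI := hsep
  haveI := hft
  haveI := hqc
  haveI := hX.isReduced
  haveI : IsProper π := hπ.isProper
  have hE : Scheme.IsExcellent X := Scheme.isExcellent_of_locallyOfFiniteType Stacks07QW_field_holds f
  have hmono : ∀ z : X', Scheme.hsFun X' N z ≤ Scheme.hsFun X N (π.base z) := fun z =>
    hπ.hsFun_le_of_isPermissible hE hD N z
  exact ⟨⟨k, ‹_›, ‹_›, π ≫ f, inferInstance, inferInstance, inferInstance⟩, hπ.isReduced_of_isReduced,
    hπ.topologicalKrullDim_le_of_isLocallyNoetherian hX.dim_le,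
    Scheme.maximal_hsValues_of_hmono N (fun z => π.base z) hmono hX.maximal ⟨x', hν⟩, hcl, hν⟩

/-- **Point centres.** If `(X, x)` is a maximal origin, `x₀ ∈ X` a closed point with `dim 𝒪_{X,x₀} > 0` (so that the reduced point
`{x₀}` is a permissible centre, CJS Def. 3.1 (2)), `π : X' → X` the blow-up of `X` in `{x₀}`, and `x' ∈ X'` a closed point with
`H^N_{X'}(x') = ν`, then `(X', x')` is a maximal origin for `(p, N, ν)`. [cite: CossartJannsenSaito2020, Def. 3.1 (2), Cor. 3.12] -/
theorem IsMaximalOrigin.of_isBlowup_singleton {X X' : Scheme.{u}} [IsLocallyNoetherian X] {x : X}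
    (hX : IsMaximalOrigin p N ν X x) {x₀ : X} (h₀ : IsClosed ({x₀} : Set X))
    (hpos : 0 < ringKrullDim (X.presheaf.stalk x₀)) {π : X' ⟶ X}
    (hπ : IsBlowup π (Scheme.IdealSheafData.vanishingIdeal ⟨{x₀}, h₀⟩)) {x' : X'} (hcl : IsClosed ({x'} : Set X'))
    (hν : Scheme.hsFun X' N x' = ν) : IsMaximalOrigin p N ν X' x' :=
  hX.of_isBlowup_of_isPermissible hπ (isPermissible_vanishingIdeal_singleton_of_ringKrullDim_pos h₀ hpos) hcl hν

/-- `1 ≤ ē_{x₀}(X)` gives `dim 𝒪_{X,x₀} > 0` (`ē ≤ dim 𝒪`, CJS Def. 2.21). [cite: CossartJannsenSaito2020, Def. 2.21] -/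
theorem ringKrullDim_stalk_pos_of_one_le_geomDirDim {X : Scheme.{u}} [IsLocallyNoetherian X] {x₀ : X}
    (he : 1 ≤ Scheme.geomDirDim X x₀) : 0 < ringKrullDim (X.presheaf.stalk x₀) := by
  have h1 : ((1 : ℕ) : WithBot ℕ∞) ≤ ringKrullDim (X.presheaf.stalk x₀) :=
    le_trans (by exact_mod_cast he) (Scheme.natCast_geomDirDim_le_ringKrullDim_stalk x₀)
  exact lt_of_lt_of_le (by decide) h1

/-- **Point centres at `ē ≥ 1`.** As `of_isBlowup_singleton`, with the dimension hypothesis read off `1 ≤ ē_{x₀}(X)` (every grade of the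
W-ladder above `0`; the W-top towers have `ē = 3`). [cite: CossartJannsenSaito2020, Def. 3.1 (2), Cor. 3.12] -/
theorem IsMaximalOrigin.of_isBlowup_singleton_of_le_geomDirDim {X X' : Scheme.{u}} [IsLocallyNoetherian X] {x : X}
    (hX : IsMaximalOrigin p N ν X x) {x₀ : X} (h₀ : IsClosed ({x₀} : Set X)) (he : 1 ≤ Scheme.geomDirDim X x₀)
    {π : X' ⟶ X} (hπ : IsBlowup π (Scheme.IdealSheafData.vanishingIdeal ⟨{x₀}, h₀⟩)) {x' : X'}
    (hcl : IsClosed ({x'} : Set X')) (hν : Scheme.hsFun X' N x' = ν) : IsMaximalOrigin p N ν X' x' :=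
  hX.of_isBlowup_singleton h₀ (ringKrullDim_stalk_pos_of_one_le_geomDirDim he) hπ hcl hν

end CampaignW42

end Summit.ResolutionOfSingularities.ResolutionOfSingularities.Theorems

/-! ## §2. Every stage of an isolated E3 point tower over a maximal origin is a maximal origin -/

namespace Summit.ResolutionOfSingularities.ResolutionOfSingularities.Cruxes.SigmaMaxModifications.IdeasL1Idea2R4

universe u

variable {p N : ℕ} {ν : ℕ → ℕ}

open Literature.AlgebraicGeometry.Resolution Literature.RingTheory.HilbertSamuel
open Literature.AlgebraicGeometry.CossartJannsenSaito2020
open Summit.ResolutionOfSingularities.ResolutionOfSingularities.Theorems.CampaignW42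
open Summit.ResolutionOfSingularities.ResolutionOfSingularities.Theorems.SigmaMaxModificationsCorridor3
open Summit.ResolutionOfSingularities.ResolutionOfSingularities.Theorems.SigmaMaxModificationsCorridor3.Helpers (QPointed)

/-- The centre of the `n`-th blow-up of an isolated point tower, as a closed set, is the marked point. [folklore] -/
theorem IsIsoPointTower.closeds_centre_eq {T : BlowupTower.{u}} {pt : ∀ n, T.X n} (hT : IsIsoPointTower N ν T pt) (n : ℕ) :
    (⟨T.C n, T.isClosed_C n⟩ : Closeds (T.X n)) = ⟨{pt n}, hT.2.2.1 n⟩ :=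
  Closeds.ext (hT.1 n)

/-- Along an isolated point tower the `n`-th blow-down map is the blow-up of the marked closed point `pt n` (reduced structure).
[cite: CossartJannsenSaito2020, Def. 6.34, Def. 6.38] -/
theorem IsIsoPointTower.isBlowup_singleton {T : BlowupTower.{u}} {pt : ∀ n, T.X n} (hT : IsIsoPointTower N ν T pt) (n : ℕ) :
    IsBlowup (T.π n) (Scheme.IdealSheafData.vanishingIdeal ⟨{pt n}, hT.2.2.1 n⟩) := by
  rw [← hT.closeds_centre_eq n]
  exact T.isBlowup n

/-- **EVERY STAGE OF AN ISOLATED E3 POINT TOWER OVER A MAXIMAL ORIGIN IS A MAXIMAL ORIGIN** for the same `(p, N, ν)`: the centres are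
the marked closed points `pt n`, of geometric directrix dimension `≥ 3 ≥ 1` (permissible), and `H^N(pt (n+1)) = ν` (near), so §1
applies at every floor. [cite: CossartJannsenSaito2020, Def. 6.38, Cor. 3.12] -/
theorem IsIsoPointTower.isMaximalOrigin {T : BlowupTower.{u}} {pt : ∀ n, T.X n} (hT : IsIsoPointTower N ν T pt)
    (h0 : IsMaximalOrigin p N ν (T.X 0) (pt 0)) (n : ℕ) : IsMaximalOrigin p N ν (T.X n) (pt n) := by
  induction n with
  | zero => exact h0
  | succ n ih =>
    haveI : IsLocallyNoetherian (T.X n) := T.ln n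
    have he : 1 ≤ @Scheme.geomDirDim (T.X n) (T.ln n) (pt n) := le_trans (by decide) (hT.2.2.2.2.2 n)
    exact ih.of_isBlowup_singleton_of_le_geomDirDim (hT.2.2.1 n) he (hT.isBlowup_singleton n) (hT.2.2.1 (n + 1))
      (hT.2.2.2.1 (n + 1))

/-- Hence `ν` is a MAXIMAL value of `H^N` on every stage of such a tower … [cite: CossartJannsenSaito2020, Cor. 3.12] -/
theorem IsIsoPointTower.maximal_hsValues {T : BlowupTower.{u}} {pt : ∀ n, T.X n} (hT : IsIsoPointTower N ν T pt)
    (h0 : IsMaximalOrigin p N ν (T.X 0) (pt 0)) (n : ℕ) : Maximal (· ∈ Scheme.hsValues (T.X n) N) ν :=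
  (hT.isMaximalOrigin h0 n).maximal

/-- … the `ν`-stratum of every stage lies in its Hilbert–Samuel locus … [cite: CossartJannsenSaito2020, Def. 2.35] -/
theorem IsIsoPointTower.hsStratum_subset_hsMaxLocus {T : BlowupTower.{u}} {pt : ∀ n, T.X n} (hT : IsIsoPointTower N ν T pt)
    (h0 : IsMaximalOrigin p N ν (T.X 0) (pt 0)) (n : ℕ) : Scheme.hsStratum (T.X n) N ν ⊆ Scheme.hsMaxLocus (T.X n) N :=
  (hT.isMaximalOrigin h0 n).hsStratum_subset_hsMaxLocus

/-- … `H^N ≤ ν` on an open neighbourhood of every marked point (upper semicontinuity at a point of a maximal stratum) …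
[cite: CossartJannsenSaito2020, Thm. 2.33, Lemma 2.36] -/
theorem IsIsoPointTower.exists_isOpen_forall_hsFun_le {T : BlowupTower.{u}} {pt : ∀ n, T.X n} (hT : IsIsoPointTower N ν T pt)
    (h0 : IsMaximalOrigin p N ν (T.X 0) (pt 0)) (n : ℕ) :
    ∃ V : Set (T.X n), IsOpen V ∧ pt n ∈ V ∧ ∀ v ∈ V, Scheme.hsFun (T.X n) N v ≤ ν := by
  haveI : IsLocallyNoetherian (T.X n) := T.ln n
  exact (hT.isMaximalOrigin h0 n).exists_isOpen_forall_hsFun_le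

/-- … an open `U ∋ pt n` of every stage meets the `ν`-stratum in `pt n` only … [cite: CossartJannsenSaito2020, Def. 13.3] -/
theorem IsIsoPointTower.exists_isOpen_inter_hsStratum_eq {T : BlowupTower.{u}} {pt : ∀ n, T.X n}
    (hT : IsIsoPointTower N ν T pt) (h0 : IsMaximalOrigin p N ν (T.X 0) (pt 0)) (n : ℕ) :
    ∃ U : Set (T.X n), IsOpen U ∧ pt n ∈ U ∧ U ∩ Scheme.hsStratum (T.X n) N ν = {pt n} := by
  haveI : IsLocallyNoetherian (T.X n) := T.ln n
  exact (hT.isMaximalOrigin h0 n).exists_isOpen_inter_hsStratum_eq (hT.2.2.2.2.1 n)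

/-- … and every stage carries the POINTED restart data: an open `U ∋ pt n` with `U ∩ T_n(ν) = {pt n}` on which `(U, pt n)` is a
pointed maximal origin. [cite: CossartJannsenSaito2020, Def. 13.3, Rem. 6.29 (1)] -/
theorem IsIsoPointTower.exists_opens_pointed {T : BlowupTower.{u}} {pt : ∀ n, T.X n} (hT : IsIsoPointTower N ν T pt)
    (h0 : IsMaximalOrigin p N ν (T.X 0) (pt 0)) (n : ℕ) :
    ∃ (U : (T.X n).Opens) (h : pt n ∈ U), (U : Set (T.X n)) ∩ Scheme.hsStratum (T.X n) N ν = {pt n} ∧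
      IsMaximalOrigin p N ν (U : Scheme.{u}) (⟨pt n, h⟩ : U) ∧ QPointed N ν (U : Scheme.{u}) (⟨pt n, h⟩ : U) := by
  haveI : IsLocallyNoetherian (T.X n) := T.ln n
  exact (hT.isMaximalOrigin h0 n).exists_opens_pointed_of_isIsolatedInHSMaxLocus (hT.2.2.2.2.1 n)

end Summit.ResolutionOfSingularities.ResolutionOfSingularities.Cruxes.SigmaMaxModifications.IdeasL1Idea2R4

end
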